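import Summits.QuantumFields.GaugeBoot.DiagonalRPTorusClusterTerms
import Summits.QuantumFields.GaugeBoot.DiagonalRPTorusCharacterMoments
import Summits.QuantumFields.GaugeBoot.DiagonalRPTorusNegativeOdd
import HarnessLib

/-!
# Closed-half diagonal RP fails on odd three-tori for `G ≅ SU(N)` at small coupling
(gauge-boot, task L3(ξ), main file)

HONEST FRAMING (cell `pub-gaugeboot`, page 1 of every file): the venture produces certified bounds
on lattice expectations at stated coupling, gauge group, dimension and torus size; NOT a mass gap,
NOT a continuum limit, NOT a string tension; NOT Yang–Mills-summit-bearing (barriers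
`FixedCouplingUltralocality`, `PerturbativeInvisibility`). This module is a structural NEGATIVE
result about which positivity constraints a TORUS certificate may use; it discharges nothing else.

## Content

`DiagonalRPTorusNegativeOdd` (L3(ν)) refutes the torus transplant `DiagonalReflectionPositive`
of closed-half diagonal RP on every odd three-torus for gauge groups WITH A SIGN CHARACTER (`ℤ₂`
and the like). The venture's own groups `SU(2)`, `SU(3)` have no sign character. Here the same
Polyakov-loop witness `F = P_X - P_Y`, `X = (c,0)`, `Y = (-1,c)`, `L = 2c+1`, is run through the
small-`β` expansion `e^{β Re tr U_p} = 1 + g_p` with the first two HAAR MOMENTS of the fundamental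
character in place of the `ℤ₂` character expansion:

* `rpForm_eq_sum` — the RP form `∫ (ΘF) F ∏_p e^{β Re tr ρ(U_p)}` is the sum over plaquette sets
  `S` of four pair terms (`DiagRPSUN.pairTerm`);
* `rpForm_le` — for `ρ z₀ = ω • 1` (`ω ≠ 1`), `0 ≤ β`, `2βN ≤ 1`, `L ≥ 3` odd:
  `RP form ≤ -β^L (I₁ + I₂) + C β^{L+1}` with the two LADDER INTEGRALS `I₁, I₂ > 0` of
  `DiagonalRPTorusPolyakovLadderValue` (cross pairs `(θX, Y)`, `(θY, X)` are adjacent columns;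
  the diagonal pairs differ in both coordinates; centre-twist vanishing and cover counting of
  `DiagonalRPTorusPolyakovCover`, crude bounds of `DiagonalRPTorusClusterTerms`);
* **`not_diagonalReflectionPositive_odd_of_moments`** — for every compact metrisable `G`, every
  continuous `ρ` with a centre element `ρ z₀ = ω • 1`, `ω ≠ 1`, and the character identities
  (R1), (R2) with positive constants: `∃ β₀ > 0, ∀ 0 < β ≤ β₀, ¬ DiagonalReflectionPositive
  (d := 3) (L := L) ρ β 0 1` for every odd `L ≥ 3`;
* **`not_diagonalReflectionPositive_odd_specialUnitary`** — the same for every `G ≅ SU(N)`,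
  `N ≥ 2` (`IsSpecialUnitaryModel ρ`; (R1), (R2) and the centre from
  `DiagonalRPTorusCharacterMoments`), and **`not_diagonalReflectionPositive_odd_suN`** for the
  concrete `Matrix.specialUnitaryGroup (Fin N) ℂ` with its defining representation.

The window `β₀` depends on `L`, `N` (it is not uniform in `L`, unlike the `ℤ₂` theorem of L3(ν)).
MEANING (one sentence): the finite-torus transplant of closed-half diagonal RP fails on odd
three-tori for the venture's own gauge groups `SU(2)`, `SU(3)` at small coupling — the `d = 2`
theorem `DiagRPTwo.diagonalReflectionPositive_two_odd` (L3(θ)) has no `d = 3` analogue for them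
either. Elementary strong-coupling expansion; not in print as far as the cell's searches go.
-/

open MeasureTheory Complex Finset Function
open scoped ComplexOrder

namespace Summit.QuantumFields.GaugeBoot

open Literature.MathematicalPhysics.QuantumFieldTheory
open Literature.MathematicalPhysics.QuantumFieldTheory.PlaquetteLowerBound (reTr)
open Literature.RepresentationTheory.CompactGroups

noncomputable section

namespace DiagRPSUN

open DiagRPThree DiagRPPolyakov

/-! ## The RP form of `P_X - P_Y` and its cluster expansion -/

section Expansion

variable {L : ℕ} [NeZero L] {N : ℕ} {G : Type*} [Group G] [TopologicalSpace G]
  [IsTopologicalGroup G] [CompactSpace G] [MeasurableSpace G] [BorelSpace G]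
  [SecondCountableTopology G] (ρ : G →* Matrix (Fin N) (Fin N) ℂ) (β : ℝ)

/-- The RP form `∫ (P_{θX} - P_{θY})(P_X - P_Y) ∏_p e^{β Re tr ρ(U_p)} ∏ dU` (the Boltzmann
weight without its constant `e^{-βN·#plaquettes}` and without `Z⁻¹`). -/
def rpForm (X Y : ZMod L × ZMod L) : ℝ :=
  ∫ U, (polRe ρ 2 U (vsite X.swap 0) - polRe ρ 2 U (vsite Y.swap 0)) *
      (polRe ρ 2 U (vsite X 0) - polRe ρ 2 U (vsite Y 0)) *
      ∏ p, Real.exp (β * WilsonRP.plaqRe ρ U p) ∂Measure.pi fun _ : Edge 3 L => haarProbability G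

/-- **Cluster expansion of the RP form**: a finite sum over plaquette sets of four pair terms. -/
theorem rpForm_eq_sum (hρ : Continuous ρ) (X Y : ZMod L × ZMod L) :
    rpForm ρ β X Y = ∑ S ∈ (univ : Finset (Plaquette 3 L)).powerset,
      (pairTerm ρ β S X.swap X - pairTerm ρ β S X.swap Y - pairTerm ρ β S Y.swap X +
        pairTerm ρ β S Y.swap Y) := by
  have hexp : ∀ U : GaugeConfig 3 L G, ∏ p, Real.exp (β * WilsonRP.plaqRe ρ U p) =
      ∑ S ∈ (univ : Finset (Plaquette 3 L)).powerset, ∏ p ∈ S, gfac ρ β p U := by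
    intro U
    have h : (fun p => Real.exp (β * WilsonRP.plaqRe ρ U p)) = fun p => gfac ρ β p U + 1 := by
      funext p; unfold gfac; ring
    rw [h, prod_add]
    simp
  have hI : ∀ (S : Finset (Plaquette 3 L)) (A B : ZMod L × ZMod L), Integrable
      (fun U : GaugeConfig 3 L G => polRe ρ 2 U (vsite A 0) * polRe ρ 2 U (vsite B 0) *
        ∏ p ∈ S, gfac ρ β p U) (Measure.pi fun _ : Edge 3 L => haarProbability G) :=
    fun S A B => integrable_of_continuous_config (continuous_pairIntegrand ρ β hρ S A B)
  have hterm : ∀ S : Finset (Plaquette 3 L),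
      ∫ U, (polRe ρ 2 U (vsite X.swap 0) - polRe ρ 2 U (vsite Y.swap 0)) *
          (polRe ρ 2 U (vsite X 0) - polRe ρ 2 U (vsite Y 0)) * ∏ p ∈ S, gfac ρ β p U
        ∂Measure.pi (fun _ : Edge 3 L => haarProbability G) =
      pairTerm ρ β S X.swap X - pairTerm ρ β S X.swap Y - pairTerm ρ β S Y.swap X +
        pairTerm ρ β S Y.swap Y := by
    intro S
    have hXX := hI S X.swap X
    have hXY := hI S X.swap Y
    have hYX := hI S Y.swap X
    have hYY := hI S Y.swap Y
    have h12 : Integrable (fun U : GaugeConfig 3 L G =>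
        polRe ρ 2 U (vsite X.swap 0) * polRe ρ 2 U (vsite X 0) * ∏ p ∈ S, gfac ρ β p U -
          polRe ρ 2 U (vsite X.swap 0) * polRe ρ 2 U (vsite Y 0) * ∏ p ∈ S, gfac ρ β p U)
        (Measure.pi fun _ : Edge 3 L => haarProbability G) := hXX.sub hXY
    have h123 : Integrable (fun U : GaugeConfig 3 L G =>
        polRe ρ 2 U (vsite X.swap 0) * polRe ρ 2 U (vsite X 0) * ∏ p ∈ S, gfac ρ β p U -
          polRe ρ 2 U (vsite X.swap 0) * polRe ρ 2 U (vsite Y 0) * ∏ p ∈ S, gfac ρ β p U -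
          polRe ρ 2 U (vsite Y.swap 0) * polRe ρ 2 U (vsite X 0) * ∏ p ∈ S, gfac ρ β p U)
        (Measure.pi fun _ : Edge 3 L => haarProbability G) := h12.sub hYX
    unfold pairTerm
    rw [← integral_sub hXX hXY, ← integral_sub h12 hYX, ← integral_add h123 hYY]
    exact integral_congr_ae (ae_of_all _ fun U => by ring)
  have hIt : ∀ S : Finset (Plaquette 3 L), Integrable
      (fun U : GaugeConfig 3 L G => (polRe ρ 2 U (vsite X.swap 0) - polRe ρ 2 U (vsite Y.swap 0)) *
        (polRe ρ 2 U (vsite X 0) - polRe ρ 2 U (vsite Y 0)) * ∏ p ∈ S, gfac ρ β p U)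
      (Measure.pi fun _ : Edge 3 L => haarProbability G) := fun S =>
    integrable_of_continuous_config ((((continuous_polRe ρ hρ 2 _).sub
      (continuous_polRe ρ hρ 2 _)).mul ((continuous_polRe ρ hρ 2 _).sub
      (continuous_polRe ρ hρ 2 _))).mul (continuous_finsetProd _ fun p _ => continuous_gfac ρ β hρ p))
  unfold rpForm
  simp_rw [hexp, mul_sum]
  rw [integral_finsetSum _ fun S _ => hIt S]
  exact sum_congr rfl fun S _ => hterm S

end Expansion

/-! ## The odd torus: the two cross ladders dominate -/

section Odd

variable {L : ℕ} [NeZero L] {N : ℕ} {G : Type*} [Group G] [TopologicalSpace G]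
  [IsTopologicalGroup G] [CompactSpace G] [MeasurableSpace G] [BorelSpace G]
  [SecondCountableTopology G] (ρ : G →* Matrix (Fin N) (Fin N) ℂ)

/-- **The RP form is dominated by the two cross ladders.** On the odd torus `L = 2c+1 ≥ 3`, with
`X = (c,0)`, `Y = (-1,c)`: for `ρ z₀ = ω • 1`, `ω ≠ 1`, `0 ≤ β`, `2βN ≤ 1`,
`RP form ≤ -β^L (I₁ + I₂) + C β^{L+1}`, `I₁ = I(θX, Y)`, `I₂ = I(X, θY)` the ladder integrals and
`C = 4·2^P N² (2N)^{L+1} + 2 N² 2^L N^{L+1}`, `P` the number of plaquettes. -/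
theorem rpForm_le (hρ : Continuous ρ) {z₀ : G} {ω : ℂ}
    (hz₀ : ρ z₀ = ω • (1 : Matrix (Fin N) (Fin N) ℂ)) (hω : ω ≠ 1) (c : ℕ) (hL : L = 2 * c + 1)
    (h3 : 3 ≤ L) {β : ℝ} (hβ : 0 ≤ β) (hγ : 2 * β * N ≤ 1) :
    rpForm ρ β (colX (L := L) c) (colY c) ≤
      -(β ^ L * (ladderIntegral ρ plane02 (colY (L := L) c) +
          ladderIntegral ρ plane12 (colY (L := L) c).swap)) +
        β ^ (L + 1) * (4 * 2 ^ Fintype.card (Plaquette 3 L) * N ^ 2 * (2 * N) ^ (L + 1) +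
          2 * N ^ 2 * 2 ^ L * N ^ (L + 1)) := by
  have hc1 : 1 ≤ c := by omega
  obtain ⟨hc0, hcm1⟩ := coe_c_ne (L := L) c hL hc1
  have hβN : β * N ≤ 1 := by nlinarith [mul_nonneg hβ (Nat.cast_nonneg N : (0 : ℝ) ≤ N)]
  set P : ℕ := Fintype.card (Plaquette 3 L) with hP
  set γ : ℝ := 2 * β * N with hγdef
  have hγ0 : 0 ≤ γ := by positivity
  set E : ℝ := N ^ 2 * (2 ^ L * (β * N) ^ (L + 1)) with hE
  set D : ℝ := N ^ 2 * γ ^ (L + 1) with hD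
  -- geometry of the four pairs
  have hA1 : bump plane02.1.1 (colY (L := L) c) = (colX (L := L) c).swap := by
    simp [bump, plane02, colY, colX]
  have hA2 : bump plane12.1.1 (colY (L := L) c).swap = colX (L := L) c := by
    simp [bump, plane12, colY, colX]
  have hXX0 : ((colX (L := L) c).swap).1 ≠ (colX (L := L) c).1 := by simpa [colX] using hc0.symm
  have hXX1 : ((colX (L := L) c).swap).2 ≠ (colX (L := L) c).2 := by simpa [colX] using hc0
  have hYY0 : ((colY (L := L) c).swap).1 ≠ (colY (L := L) c).1 := by simpa [colY] using hcm1
  have hYY1 : ((colY (L := L) c).swap).2 ≠ (colY (L := L) c).2 := by simpa [colY] using hcm1.symm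
  -- the four sums
  set PS := (univ : Finset (Plaquette 3 L)).powerset with hPS
  have hPScard : (PS.card : ℝ) = 2 ^ P := by
    rw [hPS, card_powerset, card_univ, hP]; push_cast; ring
  have hdiag : ∀ {A B : ZMod L × ZMod L}, A.1 ≠ B.1 → A.2 ≠ B.2 →
      |∑ S ∈ PS, pairTerm ρ β S A B| ≤ 2 ^ P * D := by
    intro A B h0 h1
    calc |∑ S ∈ PS, pairTerm ρ β S A B| ≤ ∑ S ∈ PS, |pairTerm ρ β S A B| := abs_sum_le_sum_abs _ _
      _ ≤ ∑ _S ∈ PS, D := sum_le_sum fun S _ =>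
          abs_pairTerm_le_of_apart ρ β hρ hz₀ hω hβ hγ (by omega) h0 h1 S
      _ = 2 ^ P * D := by rw [sum_const, nsmul_eq_mul, hPScard]
  have hcross : ∀ (pl : {q : Fin 3 × Fin 3 // q.1 < q.2}) (hpl : pl.1.2 = 2) (B : ZMod L × ZMod L),
      β ^ L * ladderIntegral ρ pl B - E - 2 ^ P * D ≤
        ∑ S ∈ PS, pairTerm ρ β S (bump pl.1.1 B) B := by
    intro pl hpl B
    have hmem : ladder B pl ∈ PS := by rw [hPS, mem_powerset]; exact subset_univ _
    rw [← add_sum_erase PS _ hmem]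
    have h1 : β ^ L * ladderIntegral ρ pl B - E ≤ pairTerm ρ β (ladder B pl) (bump pl.1.1 B) B := by
      have h := abs_pairTerm_ladder_sub_le ρ β hρ hβ hβN pl B
      rw [abs_le] at h
      linarith [h.1]
    have h2 : |∑ S ∈ PS.erase (ladder B pl), pairTerm ρ β S (bump pl.1.1 B) B| ≤ 2 ^ P * D := by
      calc |∑ S ∈ PS.erase (ladder B pl), pairTerm ρ β S (bump pl.1.1 B) B|
          ≤ ∑ S ∈ PS.erase (ladder B pl), |pairTerm ρ β S (bump pl.1.1 B) B| :=
            abs_sum_le_sum_abs _ _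
        _ ≤ ∑ _S ∈ PS.erase (ladder B pl), D := sum_le_sum fun S hS =>
            abs_pairTerm_le_of_adjacent ρ β hρ hz₀ hω hβ hγ h3 pl hpl B (ne_of_mem_erase hS)
        _ ≤ 2 ^ P * D := by
            rw [sum_const, nsmul_eq_mul]
            refine mul_le_mul_of_nonneg_right ?_ (by positivity)
            rw [← hPScard]
            exact_mod_cast card_le_card (erase_subset _ _)
    rw [abs_le] at h2
    linarith [h2.1]
  -- assemble
  rw [rpForm_eq_sum ρ β hρ, ← hPS]
  simp only [sum_add_distrib, sum_sub_distrib]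
  have ha := hdiag hXX0 hXX1
  have hd := hdiag hYY0 hYY1
  have hb := hcross plane02 rfl (colY c)
  rw [hA1] at hb
  have hc' := hcross plane12 rfl (colY c).swap
  rw [hA2] at hc'
  have hcomm : ∑ S ∈ PS, pairTerm ρ β S (colY (L := L) c).swap (colX c) =
      ∑ S ∈ PS, pairTerm ρ β S (colX (L := L) c) (colY c).swap :=
    sum_congr rfl fun S _ => pairTerm_comm ρ β S _ _
  rw [abs_le] at ha hd
  have hγpow : γ ^ (L + 1) = β ^ (L + 1) * (2 * N) ^ (L + 1) := by
    rw [hγdef, show 2 * β * (N : ℝ) = β * (2 * N) by ring, mul_pow]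
  have hβNpow : (β * N) ^ (L + 1) = β ^ (L + 1) * N ^ (L + 1) := mul_pow _ _ _
  have hDE : 4 * (2 ^ P * D) + 2 * E = β ^ (L + 1) * (4 * 2 ^ P * N ^ 2 * (2 * N) ^ (L + 1) +
      2 * N ^ 2 * 2 ^ L * N ^ (L + 1)) := by
    rw [hD, hE, hγpow, hβNpow]; ring
  linarith [ha.2, hd.2, hb, hc', hcomm]

omit [NeZero L] [TopologicalSpace G] [IsTopologicalGroup G] [CompactSpace G] [MeasurableSpace G]
  [BorelSpace G] [SecondCountableTopology G] in
/-- `P_X - P_Y` (real) is an observable of the closed diagonal half on the odd torus: both columns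
`X = (c,0)`, `Y = (-1,c)` lie at the level `c = (L-1)/2`. -/
theorem isDiagonalHalfObservable_polReDiff (c : ℕ) (hL : L = 2 * c + 1) :
    IsDiagonalHalfObservable (0 : Fin 3) 1 fun U : GaugeConfig 3 L G =>
      ((polRe ρ 2 U (vsite (colX (L := L) c) 0) - polRe ρ 2 U (vsite (colY (L := L) c) 0) : ℝ) : ℂ) := by
  have hlev : ((c : ZMod L)).val ≤ L / 2 := by
    rw [ZMod.val_natCast, Nat.mod_eq_of_lt (by omega)]
    omega
  have hY : (-1 : ZMod L) - (c : ZMod L) = (c : ZMod L) := by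
    have h : ((2 * c + 1 : ℕ) : ZMod L) = 0 := by rw [← hL, ZMod.natCast_self]
    push_cast at h
    linear_combination -h
  intro U V hUV
  have key : ∀ A : ZMod L × ZMod L, A.1 - A.2 = (c : ZMod L) →
      ∀ e : Edge 3 L, ccnt A e ≠ 0 → U e = V e := by
    intro A hA e he
    obtain ⟨h2, h0, h1⟩ := ccnt_ne_zero he
    refine hUV e ?_ ?_
    · rw [h0, h1, hA]
      exact hlev
    · rw [h2, WilsonRP.shift_apply_of_ne e.1 (show (0 : Fin 3) ≠ 2 by decide),
        WilsonRP.shift_apply_of_ne e.1 (show (1 : Fin 3) ≠ 2 by decide), h0, h1, hA]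
      exact hlev
  simp only [polRe_vsite_congr ρ (colX c) (key (colX c) (by simp [colX])),
    polRe_vsite_congr ρ (colY c) (key (colY c) (by simpa [colY] using hY))]

omit [SecondCountableTopology G] in
/-- **The RP expectation of the witness is a positive multiple of the RP form**:
`⟨(ΘF)‾ F⟩_{Λ,β} = Z⁻¹ e^{-βN·#plaquettes} · rpForm`, `F = P_X - P_Y`. -/
theorem wilsonExpectation_witness_eq (hρ : Continuous ρ) (β : ℝ) (X Y : ZMod L × ZMod L) :
    wilsonExpectation ρ β (fun U : GaugeConfig 3 L G => (starRingEnd ℂ)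
        (((polRe ρ 2 (configDiagSwap (0 : Fin 3) 1 U) (vsite X 0) -
          polRe ρ 2 (configDiagSwap (0 : Fin 3) 1 U) (vsite Y 0) : ℝ) : ℂ)) *
        ((polRe ρ 2 U (vsite X 0) - polRe ρ 2 U (vsite Y 0) : ℝ) : ℂ)) =
      ((((partitionFunction (d := 3) (L := L) ρ β)⁻¹).toReal *
        (Real.exp (-(β * (N * Fintype.card (Plaquette 3 L)))) * rpForm ρ β X Y) : ℝ) : ℂ) := by
  have hint : (fun U : GaugeConfig 3 L G => (starRingEnd ℂ)
        (((polRe ρ 2 (configDiagSwap (0 : Fin 3) 1 U) (vsite X 0) -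
          polRe ρ 2 (configDiagSwap (0 : Fin 3) 1 U) (vsite Y 0) : ℝ) : ℂ)) *
        ((polRe ρ 2 U (vsite X 0) - polRe ρ 2 U (vsite Y 0) : ℝ) : ℂ)) =
      fun U => ((((polRe ρ 2 U (vsite X.swap 0) - polRe ρ 2 U (vsite Y.swap 0)) *
        (polRe ρ 2 U (vsite X 0) - polRe ρ 2 U (vsite Y 0)) : ℝ) : ℂ)) := by
    funext U
    rw [Complex.conj_ofReal, polRe_configDiagSwap_vsite, polRe_configDiagSwap_vsite]
    push_cast
    ring
  rw [hint, wilsonExpectation_ofReal_eq ρ hρ β]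
  have hw : ∀ U : GaugeConfig 3 L G, Real.exp (-β * wilsonAction ρ U) =
      Real.exp (-(β * (N * Fintype.card (Plaquette 3 L)))) *
        ∏ p, Real.exp (β * WilsonRP.plaqRe ρ U p) := by
    intro U
    rw [WilsonRP.wilsonAction_eq, ← Real.exp_sum, ← Real.exp_add]
    congr 1
    rw [← mul_sum]
    ring
  congr 1
  congr 1
  unfold rpForm
  rw [← integral_const_mul]
  refine integral_congr_ae (ae_of_all _ fun U => ?_)
  dsimp only
  rw [hw U]
  ring

/-- ★ **Closed-half diagonal RP fails on odd three-tori at small coupling, from the character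
moments.** Let `G` be a compact metrisable group, `ρ` continuous with `N ≥ 1`, with a centre
element `ρ z₀ = ω • 1`, `ω ≠ 1`, and with the character identities
(R1) `∫ Re χ(x g⁻¹) Re χ(g y) dg = c₁ Re χ(x y)`, (R2) `∫ Re χ(g x g⁻¹ y) dg = c₂ Re(χ(x) χ(y))`,
`c₁, c₂ > 0`. Then for every odd `L ≥ 3` there is `β₀ > 0` such that
`¬ DiagonalReflectionPositive (d := 3) (L := L) ρ β 0 1` for all `0 < β ≤ β₀`. -/
theorem not_diagonalReflectionPositive_odd_of_moments (hLodd : Odd L) (h3 : 3 ≤ L)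
    (hρ : Continuous ρ) (hN : 1 ≤ N) {z₀ : G} {ω : ℂ}
    (hz₀ : ρ z₀ = ω • (1 : Matrix (Fin N) (Fin N) ℂ)) (hω : ω ≠ 1) {c₁ c₂ : ℝ} (hc₁ : 0 < c₁)
    (hc₂ : 0 < c₂)
    (hR1 : ∀ x y : G, ∫ g, reTr ρ (x * g⁻¹) * reTr ρ (g * y) ∂haarProbability G =
      c₁ * reTr ρ (x * y))
    (hR2 : ∀ x y : G, ∫ g, reTr ρ (g * x * g⁻¹ * y) ∂haarProbability G =
      c₂ * ((ρ x).trace * (ρ y).trace).re) :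
    ∃ β₀ : ℝ, 0 < β₀ ∧ ∀ β : ℝ, 0 < β → β ≤ β₀ →
      ¬ DiagonalReflectionPositive (d := 3) (L := L) ρ β 0 1 := by
  obtain ⟨c, hc⟩ := hLodd
  have hL1 : 1 < L := by omega
  set I₁ := ladderIntegral ρ plane02 (colY (L := L) c) with hI₁
  set I₂ := ladderIntegral ρ plane12 (colY (L := L) c).swap with hI₂
  have hI₁pos : 0 < I₁ := ladderIntegral_pos ρ plane02 _ rfl hρ hL1 hN hc₁ hc₂ hR1 hR2
  have hI₂pos : 0 < I₂ := ladderIntegral_pos ρ plane12 _ rfl hρ hL1 hN hc₁ hc₂ hR1 hR2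
  set C : ℝ := 4 * 2 ^ Fintype.card (Plaquette 3 L) * N ^ 2 * (2 * N) ^ (L + 1) +
    2 * N ^ 2 * 2 ^ L * N ^ (L + 1) with hC
  have hNpos : (0 : ℝ) < N := by exact_mod_cast hN
  have hCpos : 0 < C := by positivity
  refine ⟨min (1 / (2 * N)) ((I₁ + I₂) / (2 * C)), lt_min (by positivity) (by positivity),
    fun β hβ hβ0 hRP => ?_⟩
  have hγ : 2 * β * N ≤ 1 := by
    have h := (le_min_iff.1 hβ0).1
    rw [le_div_iff₀ (by positivity)] at h
    linarith
  have hβC : β * C < I₁ + I₂ := by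
    have h := (le_min_iff.1 hβ0).2
    rw [le_div_iff₀ (by positivity)] at h
    linarith
  -- the RP form is negative
  have hneg : rpForm ρ β (colX (L := L) c) (colY c) < 0 := by
    have h := rpForm_le ρ hρ hz₀ hω c hc h3 hβ.le hγ
    have hpow : 0 < β ^ L := pow_pos hβ L
    have : -(β ^ L * (I₁ + I₂)) + β ^ (L + 1) * C = -(β ^ L * ((I₁ + I₂) - β * C)) := by ring
    rw [← hI₁, ← hI₂, ← hC, this] at h
    nlinarith [mul_pos hpow (sub_pos.2 hβC)]
  -- but diagonal RP would make it non-negative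
  have hF := hRP (fun U : GaugeConfig 3 L G =>
      ((polRe ρ 2 U (vsite (colX (L := L) c) 0) - polRe ρ 2 U (vsite (colY (L := L) c) 0) : ℝ) : ℂ))
    (Complex.measurable_ofReal.comp ((continuous_polRe ρ hρ 2 _).sub
      (continuous_polRe ρ hρ 2 _)).measurable)
    ⟨N + N, fun U => by
      rw [Complex.norm_real, Real.norm_eq_abs]
      exact (abs_sub _ _).trans (add_le_add (abs_polRe_le ρ hρ 2 U _) (abs_polRe_le ρ hρ 2 U _))⟩
    (isDiagonalHalfObservable_polReDiff ρ c hc)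
  rw [wilsonExpectation_witness_eq ρ hρ, Complex.zero_le_real] at hF
  obtain ⟨hZ0, hZtop⟩ := partitionFunction_ne_zero_ne_top (d := 3) (L := L) ρ hρ β
  have hZ : 0 < ((partitionFunction (d := 3) (L := L) ρ β)⁻¹).toReal :=
    ENNReal.toReal_pos (ENNReal.inv_ne_zero.2 hZtop) (ENNReal.inv_ne_top.2 hZ0)
  have hpos : 0 < ((partitionFunction (d := 3) (L := L) ρ β)⁻¹).toReal *
      (Real.exp (-(β * (N * Fintype.card (Plaquette 3 L)))) *
        -rpForm ρ β (colX (L := L) c) (colY c)) :=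
    mul_pos hZ (mul_pos (Real.exp_pos _) (neg_pos.2 hneg))
  linarith

/-- ★★ **Closed-half diagonal RP fails on every odd three-torus for `G ≅ SU(N)` at small
coupling.** For every compact metrisable group `G ≅ SU(N)` (`IsSpecialUnitaryModel ρ`, `N ≥ 2`)
and every odd `L ≥ 3` there is `β₀ > 0` (depending on `L`, `N`) with
`¬ DiagonalReflectionPositive (d := 3) (L := L) ρ β 0 1` for all `0 < β ≤ β₀`: the torus
transplant of closed-half diagonal RP, true on every odd TWO-torus (L3(θ)), is false on odd
THREE-tori for the venture's own gauge groups `SU(2)`, `SU(3)`, …. -/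
theorem not_diagonalReflectionPositive_odd_specialUnitary (hρ : IsSpecialUnitaryModel ρ)
    (hN : 2 ≤ N) (hLodd : Odd L) (h3 : 3 ≤ L) :
    ∃ β₀ : ℝ, 0 < β₀ ∧ ∀ β : ℝ, 0 < β → β ≤ β₀ →
      ¬ DiagonalReflectionPositive (d := 3) (L := L) ρ β 0 1 := by
  obtain ⟨z₀, ω, hω, hz₀⟩ := exists_smul_one ρ hρ hN
  obtain ⟨c₁, hc₁, hR1⟩ := exists_re_conv_const ρ hρ hN
  have hNpos : (0 : ℝ) < N := by exact_mod_cast (show 0 < N by omega)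
  exact not_diagonalReflectionPositive_odd_of_moments ρ hLodd h3 hρ.1 (by omega) hz₀ hω hc₁
    (inv_pos.2 hNpos) hR1 (integral_re_trace_conj_mul ρ hρ)

end Odd

/-! ## The concrete groups `SU(N)` -/

section SUN

open Literature.MathematicalPhysics.QuantumLattice

/-- ★★ **`SU(N)` lattice gauge theory (`N ≥ 2`: `SU(2)`, `SU(3)`, …) violates closed-half
diagonal RP on every odd three-torus `(ℤ/L)³`, `L ≥ 3`, for all sufficiently small `β > 0`**:
the theorem `not_diagonalReflectionPositive_odd_specialUnitary` for the defining representation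
of `Matrix.specialUnitaryGroup (Fin N) ℂ` (not vacuous). -/
theorem not_diagonalReflectionPositive_odd_suN {L N : ℕ} [NeZero L] (hN : 2 ≤ N)
    (hLodd : Odd L) (h3 : 3 ≤ L) :
    ∃ β₀ : ℝ, 0 < β₀ ∧ ∀ β : ℝ, 0 < β → β ≤ β₀ →
      ¬ DiagonalReflectionPositive (d := 3) (L := L) (fundamentalRep (Fin N)) β 0 1 := by
  haveI : SecondCountableTopology (Matrix (Fin N) (Fin N) ℂ) :=
    inferInstanceAs (SecondCountableTopology (Fin N → Fin N → ℂ))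
  haveI : SecondCountableTopology (Matrix.specialUnitaryGroup (Fin N) ℂ) :=
    Topology.IsEmbedding.subtypeVal.secondCountableTopology
  exact not_diagonalReflectionPositive_odd_specialUnitary (fundamentalRep (Fin N))
    (TorusAreaLaw.isSpecialUnitaryModel_fundamentalRep N) hN hLodd h3

end SUN

end DiagRPSUN

end

end Summit.QuantumFields.GaugeBoot
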